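import Summits.BirchSwinnertonDyer.BirchSwinnertonDyer.Theses.QuadraticBranchSignedControl
import Summits.BirchSwinnertonDyer.BirchSwinnertonDyer.Theorems.QuadraticBranchSignedControlPlusEtaNonsurjLambdaTransferPeriod
import Summits.BirchSwinnertonDyer.BirchSwinnertonDyer.Theorems.QuadraticBranchSignedControlPlusEtaNonsurjOfCMCongruentTransfer
import Summits.BirchSwinnertonDyer.BirchSwinnertonDyer.Theorems.QuadraticBranchSignedControlPlusEtaCMRankZeroOfBT26
import Summits.BirchSwinnertonDyer.BirchSwinnertonDyer.Theorems.SchneiderFreeAdditiveX3PoitouTateReciprocitySumHolds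
import Summits.BirchSwinnertonDyer.BirchSwinnertonDyer.Theorems.QuadraticBranchSignedControlPlusEtaNonsurjImprimitiveTransfer
import HarnessLib

/-!
# Route `QuadraticBranchSignedControl` (rung K8, cell `bsd-potss`), crux stmt-BirchSwinnertonDyer-19606
# `PlusEtaMainConjectureNonsurj`: Part LI — THE (A)-STUB SHRINKS TO THE CM PARTNERS OF POSITIVE ANALYTIC RANK, and the `_of` of
# the rank-≤1 face. The CM rows whose partner `W` has `L(W,1) ≠ 0` are CLOSED MODULO PRINT by k8q-c2 g3's road
# (`EtaCMRankZeroBT26.etaMC_cm_rankZeroRows_of_bt26`: Burungale–Tian 2.6 + Kobayashi 2.2η + Kitajima–Otsuki 1.3 + GZK + modularity +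
# Poitou–Tate — now a TREE THEOREM, `poitouTate_selmerStructure_duality_real_holds` — + bsd.S28 = Rubin/Burungale–Flach for CM rank 0),
# so v7/v8's content stub `stub_conjA_partners_cm` is needed ONLY on the partners with `L(W,1) = 0`; the crux, and its rank-≤1 face
# (Part L), from v8's nine cite facts + four more named facts + (A) on positive-rank CM partners + analytic μ on CM rows + the
# uncongruent stub (resp. its rank-≤1 restriction)

WHY. Skeleton v7/v8 route EVERY CM row through k8eta-c2 g7's (A) + analytic-`μ` road. But on a CM row `V = C • W^{(p*)}` with
`L(W,1) ≠ 0` the node (C1⁺_η)(V,p) is a theorem modulo print since k8q-c2 g3 (p480xxx, `…PlusEtaCMRankZeroOfBT26`): Burungale–Tian's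
up-to-`p` equality + `BSD_p(W)` (bsd.S28) pin the exponent. This file composes that road into the crux's `_of`, so that the (A) input
is displayed only where it is not print — the CM partners of POSITIVE analytic rank (for those, (C1⁺_η) ⟺ `BSD_p(W)` when
`r_an(W) = 1`, k8q-c2 g4; the bare `μ`-statement when `r_an(W) ≥ 2`). The analytic `μ = 0` input stays on ALL CM rows: a CM row of
analytic rank 0 still serves as a congruence ANCHOR for non-CM rows, and the transfer (Part XLVIII §141, cite facts only) consumes
`μ_an = 0` at the anchor.

* §6 `etaMC_cmRows_of_rankZeroPrint_of_conjAPosRank_of_analyticMu` — (C1⁺_η) on EVERY CM row from: the named facts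
  `h26 h22 h6273 hmod hGZK hKO hS28` (Poitou–Tate discharged by the tree theorem), (A) on the CM partners with `L(W,1) = 0`
  (`hAcmPos`: v7's `Sig.stub_conjA_partners_cm` with ONE more binder `W.entireLFunction 1 = 0`), and v7's `Sig.stub_analyticEtaMu_cm`
  VERBATIM (`hμcm`). Split on `L(W,1) = 0` at the row's partner.
* §7 **`plusEtaMainConjectureNonsurj_of_cmConjAPosRank_of_analyticMu_of_uncongruent_of_citeFacts`** — the CRUX 19606 BY NAME from
  v8's nine cite facts (`h22 h6273 h26 h46 h53 h41 hnf hGV hGVm`), `hmod hGZK hKO hS28`, `hAcmPos`, `hμcm`, and v7's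
  `Sig.stub_etaMC_nonCM_uncongruent` VERBATIM (`huncong`) — Part XLVIII §142 with the (A)-stub SHRUNK (v9-shape `_of` candidate for the
  planner; no skeleton is registered here).
* §9 (APPENDED) **`plusEtaMainConjectureNonsurj_of_cmConjAPosRank_of_analyticMu_of_uncongruent_of_citeFacts45`** — §7 with the cite input
  `h53` (Corpuz–Lei Thm. 5.3) REPLACED by `h45` (Corpuz–Lei Thm. 4.5, the paper's central congruence; named fact p778190), `h53` being derived
  in the kernel by Part LII `EtaImprimitiveTransfer.thm53_of_thm45` (p778676): the v9 `publishedInputs` may cite 4.5 instead of 5.3.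
* §8 **`plusEtaMainConjectureNonsurjRankLeOne_of_cmConjAPosRank_of_analyticMu_of_uncongruentRankLeOne_of_citeFacts`** — the
  rank-≤1 face of Part L from the same inputs with `huncong` replaced by its RESTRICTION to the rows with a partner of analytic rank
  `≤ 1` (`huncong₁`). With Part L §4 this is a complete skeleton-shaped road «stubs ⟹ weak item ⟹ leaf».

HONEST FRAMING (cell `bsd-potss`, run/shared/lean/pub/bsd-potss/; FULL-BSD rank ≤ 1 programme, HUMAN RULING D-0036/D-0074):
COMPOSITION THEOREMS ONLY — no definition, no new named fact, no `sorry`, axioms standard; CONDITIONAL on the displayed named facts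
(none proved here except Poitou–Tate, which is cited from the tree) and on the displayed content inputs, which are OPEN class-wide
((A) on positive-rank CM partners at an inert prime; analytic `μ = 0` on CM rows; (C1⁺_η) on uncongruent non-CM rows). No stub of
19606 is closed or re-registered (planner's act); the crux and the route stay OPEN; nothing is booked; `BSD(W, p)` is claimed for no
pair. Seat `bsd-potss-k8eta-c2` g34 (prover), `--supports stmt-BirchSwinnertonDyer-19606`.

References: [BurungaleTian2026] Thm. 2.6, Rem. 2.7; [Kobayashi2003] Thm. 2.2 (p. 5), §4 + Thm. 4.1 (p. 8), Thm. 6.2–7.3, Cor. 7.2;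
[KitajimaOtsuki2018] Main Thm. 1.3; [BurungaleFlach2024] Cor. 2; [Rubin1991] Thm. 11.1; [HatleyLei2019] Thm. 4.6, Prop. 5.1;
[CorpuzLei2025] Thm. 5.3 (claim, to appear Math. Z.); [GreenbergVatsal2000] §3 Rem. 3.4; [CoatesSujatha2005] §3 statement (A);
[MilneADT2006] I Thm. 4.10.
-/

set_option autoImplicit false
set_option linter.dupNamespace false

noncomputable section

open scoped Classical

open CongruenceSubgroup Field NumberField IsDedekindDomain WeierstrassCurve
open Literature.NumberTheory.EllipticCurves
open Literature.NumberTheory.EllipticCurves.ModularForms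
open Literature.NumberTheory.EllipticCurves.Rank1Residual
open Literature.NumberTheory.EllipticCurves.Rank1Residual.Typed
open Literature.NumberTheory.GaloisRepresentations
open Literature.NumberTheory.GaloisCohomology
open Literature.NumberTheory.EllipticCurves.IwasawaAlgebra
open Literature.NumberTheory.EllipticCurves.GreenbergVatsal2000
open ZpExtension
open Summit.BirchSwinnertonDyer.Rank1Residual.Additive
open Summit.BirchSwinnertonDyer.Rank1Residual.O6 (ModPCongruent)
open Summit.BirchSwinnertonDyer.BirchSwinnertonDyer.Theses.QuadraticBranchSignedControl

namespace Summit.BirchSwinnertonDyer.BirchSwinnertonDyer.Theorems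

namespace EtaRankLeOneOf

/-! ## §6 The CM branch with the (A) input restricted to the partners of positive analytic rank -/

/-- **(C1⁺_η) on EVERY CM row of the crux, with (A) displayed ONLY on the CM partners `W` with `L(W,1) = 0`.** GRANTED the named
facts `h26` (Burungale–Tian 2.6 ∘ Kob), `h22`, `h6273` (Kobayashi 2.2η, 6.2–7.3η), `hmod` (entire `L`), `hGZK`, `hKO`
(Kitajima–Otsuki 1.3η), `hS28` (BSD for CM rank 0: Rubin / Burungale–Flach); (A) on the CM partners with `L(W,1) = 0` (`hAcmPos`), and
the analytic `μ = 0` on the CM rows (`hμcm`, v7's stub text): on a CM row `V = C • W^{(p*)}`, if `L(W,1) ≠ 0` the node is k8q-c2 g3's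
`EtaCMRankZeroBT26.etaMC_cm_rankZeroRows_of_bt26` (Poitou–Tate supplied by the tree theorem
`poitouTate_selmerStructure_duality_real_holds`), else k8eta-c2 g7's `EtaFineRoad.etaMC_cmRows_of_bt26_of_conjA_of_analyticMu` at the
row. CONDITIONAL; nothing booked. [cite: BurungaleTian2026, Thm. 2.6] [cite: Kobayashi2003, Thm. 2.2 (p. 5), Thm. 6.2–7.3, Cor. 7.2]
[cite: KitajimaOtsuki2018, Main Thm. 1.3] [cite: BurungaleFlach2024, Cor. 2] [cite: CoatesSujatha2005, §3 statement (A)] -/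
theorem etaMC_cmRows_of_rankZeroPrint_of_conjAPosRank_of_analyticMu
    (h26 : BurungaleTian2026.thm26_etaKatoSequences_charIdeal_upToP_of_cm)
    (h22 : Kobayashi2003.thm22_etaSignedSelmerDual_finite_torsion)
    (h6273 : Kobayashi2003.thm62_63_73_etaColemanPoitouTate)
    (hmod : hasEntireLFunction_rat) (hGZK : rank_eq_analyticRank_of_analyticRank_le_one)
    (hKO : KitajimaOtsuki2018.mainThm13_etaSignedSelmerDual_noFiniteSubmodule)
    (hS28 : bsdTriple_of_hasCM_of_L_one_ne_zero)
    (hAcmPos : ∀ (V : WeierstrassCurve ℚ) [V.IsElliptic] [V.IsGloballyMinimal] (W : WeierstrassCurve ℚ) [W.IsElliptic]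
        [W.IsGloballyMinimal] (C : VariableChange ℚ) (p : ℕ) [Fact p.Prime],
        5 ≤ p → C • W.quadraticTwist ((-1) ^ (p / 2) * p) = V →
        V.HasGoodReductionAtPrime p → V.frobeniusTrace p = 0 →
        ¬ (∀ m : ℕ, V.HasSurjectiveModNGaloisRep (p ^ m : ℕ)) → V.HasCM → W.entireLFunction 1 = 0 →
        ∀ (κ : ZpExtension ℚ p), κ.IsCyclotomic →
          ∃ (γ : absoluteGaloisGroup ℚ) (D : W.FineSelmerDualData κ γ),
            Module.Finite ℤ_[p] (RestrictScalars ℤ_[p] (IwasawaAlgebra p) D.X))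
    (hμcm : ∀ (V : WeierstrassCurve ℚ) [V.IsElliptic] [V.IsGloballyMinimal] (p : ℕ) [Fact p.Prime],
        5 ≤ p → V.HasGoodReductionAtPrime p → V.frobeniusTrace p = 0 →
        ¬ (∀ m : ℕ, V.HasSurjectiveModNGaloisRep (p ^ m : ℕ)) → V.HasCM →
        ∀ {N : ℕ} [NeZero N] {f : CuspForm (Gamma0 N) 2}, IsNewformOf V f →
          ∀ (ϖ : ℚ), (if Even (p / 2) then (ϖ : ℝ) * V.realPeriodRat = plusPeriod f
              else (ϖ : ℝ) * V.imaginaryPeriodRat = minusPeriod f) →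
          ∀ (Lη : IwasawaAlgebra p), IsQuadraticBranchPlusLFunction f p ϖ Lη → HasUnitContent Lη) :
    ∀ (V : WeierstrassCurve ℚ) [V.IsElliptic] [V.IsGloballyMinimal] (p : ℕ) [Fact p.Prime],
      5 ≤ p → V.HasGoodReductionAtPrime p → V.frobeniusTrace p = 0 →
      ¬ (∀ m : ℕ, V.HasSurjectiveModNGaloisRep (p ^ m : ℕ)) → V.HasCM →
        QuadraticBranchPlusEtaMainConjectureAt V p := by
  intro V _ _ p _ hp5 hgood hap hns hCM
  obtain ⟨W, _, _, C, hCV⟩ := TwistPartner.exists_isGloballyMinimal_pStarPartner V p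
  by_cases hLW : W.entireLFunction 1 = 0
  · -- positive analytic rank at the partner: g7's (A) + analytic-μ road at the row
    exact EtaFineRoad.etaMC_cmRows_of_bt26_of_conjA_of_analyticMu h26 h22 h6273 V p hp5 hgood hap hns hCM W C hCV
      (hAcmPos V W C p hp5 hCV hgood hap hns hCM hLW) (hμcm V p hp5 hgood hap hns hCM)
  · -- analytic rank 0 at the partner: PRINT (BT26 + BSD_p(W) from bsd.S28), Poitou–Tate a tree theorem
    exact EtaCMRankZeroBT26.etaMC_cm_rankZeroRows_of_bt26 h26
      (SchneiderFreeAdditiveX3.PoitouTateReduction.poitouTate_selmerStructure_duality_real_holds ℚ) hmod hGZK h22 hKO hS28 V p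
      hp5 hgood hap hns hCM W C hCV hLW

/-! ## §7 The crux BY NAME with the (A)-stub shrunk (v9-shape `_of`) -/

/-- **THE CRUX `PlusEtaMainConjectureNonsurj` FROM v8's CITE FACTS + FOUR NAMED FACTS + (A) ON THE POSITIVE-RANK CM PARTNERS + ANALYTIC μ ON
THE CM ROWS + THE UNCONGRUENT STUB.** Part XLVIII §142 (k8eta-c2 g33) with its CM branch replaced by §6: GRANTED `h22 h6273 h26 h46 h53 h41
hnf hGV hGVm` (v8's `stub_etaMC_publishedInputs`), `hmod hGZK hKO hS28`, the content inputs `hAcmPos` ((A) on the CM partners with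
`L(W,1) = 0` — v7's `Sig.stub_conjA_partners_cm` with one more binder), `hμcm` (v7's `Sig.stub_analyticEtaMu_cm` verbatim) and `huncong`
(v7's `Sig.stub_etaMC_nonCM_uncongruent` verbatim). CM rows: §6; non-CM rows congruent to a CM row `V″`: §6 at `V″` + `hμcm V″` + the
transfer binder from cite facts (`EtaLambdaTransfer.corpuzLei2025_etaPlusMainConjecture_transfer_anMu_of_citeFacts`); the rest: `huncong`.
CONDITIONAL; registers / closes no stub; nothing booked. [cite: Kobayashi2003, Thm. 2.2 (p. 5), §4 + Thm. 4.1 (p. 8), Thm. 6.2–7.3]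
[cite: BurungaleTian2026, Thm. 2.6] [cite: HatleyLei2019, Thm. 4.6, Prop. 5.1] [claim: CorpuzLei2025, status: under-review]
[cite: GreenbergVatsal2000, §3 Remark 3.4] [cite: KitajimaOtsuki2018, Main Thm. 1.3] [cite: BurungaleFlach2024, Cor. 2]
[cite: CoatesSujatha2005, §3 statement (A)] [cite: Zywina2015, Prop. 1.14 and Prop. 1.16] -/
theorem plusEtaMainConjectureNonsurj_of_cmConjAPosRank_of_analyticMu_of_uncongruent_of_citeFacts
    (h22 : Kobayashi2003.thm22_etaSignedSelmerDual_finite_torsion)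
    (h6273 : Kobayashi2003.thm62_63_73_etaColemanPoitouTate)
    (h26 : BurungaleTian2026.thm26_etaKatoSequences_charIdeal_upToP_of_cm)
    (h46 : HatleyLei2019.thm46_prop51_etaSignedMuLambda_transfer_of_torsionIso)
    (h53 : CorpuzLei2025.thm53_etaPlusAnalyticMuLambda_transfer_of_torsionIso)
    (h41 : Kobayashi2003.thm41_plusEtaCharIdeal_dvd)
    (hnf : exists_isNewformOf) (hGV : realPeriodRat_eq_unit_mul_plusPeriod)
    (hGVm : numRealComponents_mul_imaginaryPeriodRat_eq_unit_mul_minusPeriod_of_odd)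
    (hmod : hasEntireLFunction_rat) (hGZK : rank_eq_analyticRank_of_analyticRank_le_one)
    (hKO : KitajimaOtsuki2018.mainThm13_etaSignedSelmerDual_noFiniteSubmodule)
    (hS28 : bsdTriple_of_hasCM_of_L_one_ne_zero)
    (hAcmPos : ∀ (V : WeierstrassCurve ℚ) [V.IsElliptic] [V.IsGloballyMinimal] (W : WeierstrassCurve ℚ) [W.IsElliptic]
        [W.IsGloballyMinimal] (C : VariableChange ℚ) (p : ℕ) [Fact p.Prime],
        5 ≤ p → C • W.quadraticTwist ((-1) ^ (p / 2) * p) = V →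
        V.HasGoodReductionAtPrime p → V.frobeniusTrace p = 0 →
        ¬ (∀ m : ℕ, V.HasSurjectiveModNGaloisRep (p ^ m : ℕ)) → V.HasCM → W.entireLFunction 1 = 0 →
        ∀ (κ : ZpExtension ℚ p), κ.IsCyclotomic →
          ∃ (γ : absoluteGaloisGroup ℚ) (D : W.FineSelmerDualData κ γ),
            Module.Finite ℤ_[p] (RestrictScalars ℤ_[p] (IwasawaAlgebra p) D.X))
    (hμcm : ∀ (V : WeierstrassCurve ℚ) [V.IsElliptic] [V.IsGloballyMinimal] (p : ℕ) [Fact p.Prime],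
        5 ≤ p → V.HasGoodReductionAtPrime p → V.frobeniusTrace p = 0 →
        ¬ (∀ m : ℕ, V.HasSurjectiveModNGaloisRep (p ^ m : ℕ)) → V.HasCM →
        ∀ {N : ℕ} [NeZero N] {f : CuspForm (Gamma0 N) 2}, IsNewformOf V f →
          ∀ (ϖ : ℚ), (if Even (p / 2) then (ϖ : ℝ) * V.realPeriodRat = plusPeriod f
              else (ϖ : ℝ) * V.imaginaryPeriodRat = minusPeriod f) →
          ∀ (Lη : IwasawaAlgebra p), IsQuadraticBranchPlusLFunction f p ϖ Lη → HasUnitContent Lη)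
    (huncong : ∀ (V : WeierstrassCurve ℚ) [V.IsElliptic] [V.IsGloballyMinimal] (p : ℕ) [Fact p.Prime],
        5 ≤ p → V.HasGoodReductionAtPrime p → V.frobeniusTrace p = 0 →
        ¬ (∀ m : ℕ, V.HasSurjectiveModNGaloisRep (p ^ m : ℕ)) → ¬ V.HasCM →
        ¬ (∃ (V'' : WeierstrassCurve ℚ) (_ : V''.IsElliptic) (_ : V''.IsGloballyMinimal),
            V''.HasCM ∧ V''.HasGoodReductionAtPrime p ∧ V''.frobeniusTrace p = 0 ∧ ModPCongruent V'' V p) →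
        QuadraticBranchPlusEtaMainConjectureAt V p) :
    PlusEtaMainConjectureNonsurj := by
  intro V _ _ p _ hp5 hgood hap hns
  have hp2 : p ≠ 2 := by omega
  -- the CM branch with the (A) input shrunk (§6)
  have hcmRows := etaMC_cmRows_of_rankZeroPrint_of_conjAPosRank_of_analyticMu h26 h22 h6273 hmod hGZK hKO hS28 hAcmPos hμcm
  -- the transfer binder, from cite facts only (Part XLVIII §141)
  have hCL := EtaLambdaTransfer.corpuzLei2025_etaPlusMainConjecture_transfer_anMu_of_citeFacts h46 h53 h22 h41 hnf hGV hGVm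
  by_cases hCM : V.HasCM
  · exact hcmRows V p hp5 hgood hap hns hCM
  · by_cases hcg : ∃ (V'' : WeierstrassCurve ℚ) (_ : V''.IsElliptic) (_ : V''.IsGloballyMinimal),
        V''.HasCM ∧ V''.HasGoodReductionAtPrime p ∧ V''.frobeniusTrace p = 0 ∧ ModPCongruent V'' V p
    · obtain ⟨V'', _, _, hCM'', hgood'', hap'', hcong⟩ := hcg
      have hns'' : ¬ (∀ m : ℕ, V''.HasSurjectiveModNGaloisRep (p ^ m : ℕ)) := by
        intro h
        exact V''.not_hasSurjectiveModNGaloisRep_of_hasCM hCM'' (Fact.out) hp2 (by simpa using h 1)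
      exact EtaCMCongruentTransfer.quadraticBranchPlusEtaMainConjectureAt_of_congruent_of_transfer hCL p hp5 V'' hgood'' hap''
        (hcmRows V'' p hp5 hgood'' hap'' hns'' hCM'') (hμcm V'' p hp5 hgood'' hap'' hns'' hCM'') V hgood hap hcong
    · exact huncong V p hp5 hgood hap hns hCM hcg

/-! ## §8 The rank-≤1 face (Part L) from the same inputs with the uncongruent stub restricted -/

/-- **THE RANK-≤1 FACE OF THE CRUX FROM STUB-SHAPED INPUTS**: the weak statement of Part L (19606 restricted to the rows with a partner of
analytic rank `≤ 1` — the binder `closes` consumes) from the inputs of §7 with `huncong` replaced by its RESTRICTION `huncong₁` to the rows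
with such a partner (the witness is threaded through; CM rows and CM-congruent rows exactly as in §7). Composed with Part L §4
(`EtaRankLeOneFace.o5SharpGss_of_closesBinders_of_etaNonsurjRankLeOne`) this is the complete road «shrunk stubs ⟹ weak item ⟹ leaf».
CONDITIONAL; registers / closes nothing; nothing booked. [cite: Kobayashi2003, Thm. 2.2 (p. 5), §4 + Thm. 4.1 (p. 8), Thm. 6.2–7.3]
[cite: BurungaleTian2026, Thm. 2.6] [cite: HatleyLei2019, Thm. 4.6, Prop. 5.1] [claim: CorpuzLei2025, status: under-review]
[cite: GreenbergVatsal2000, §3 Remark 3.4] [cite: KitajimaOtsuki2018, Main Thm. 1.3] [cite: BurungaleFlach2024, Cor. 2]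
[cite: CoatesSujatha2005, §3 statement (A)] -/
theorem plusEtaMainConjectureNonsurjRankLeOne_of_cmConjAPosRank_of_analyticMu_of_uncongruentRankLeOne_of_citeFacts
    (h22 : Kobayashi2003.thm22_etaSignedSelmerDual_finite_torsion)
    (h6273 : Kobayashi2003.thm62_63_73_etaColemanPoitouTate)
    (h26 : BurungaleTian2026.thm26_etaKatoSequences_charIdeal_upToP_of_cm)
    (h46 : HatleyLei2019.thm46_prop51_etaSignedMuLambda_transfer_of_torsionIso)
    (h53 : CorpuzLei2025.thm53_etaPlusAnalyticMuLambda_transfer_of_torsionIso)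
    (h41 : Kobayashi2003.thm41_plusEtaCharIdeal_dvd)
    (hnf : exists_isNewformOf) (hGV : realPeriodRat_eq_unit_mul_plusPeriod)
    (hGVm : numRealComponents_mul_imaginaryPeriodRat_eq_unit_mul_minusPeriod_of_odd)
    (hmod : hasEntireLFunction_rat) (hGZK : rank_eq_analyticRank_of_analyticRank_le_one)
    (hKO : KitajimaOtsuki2018.mainThm13_etaSignedSelmerDual_noFiniteSubmodule)
    (hS28 : bsdTriple_of_hasCM_of_L_one_ne_zero)
    (hAcmPos : ∀ (V : WeierstrassCurve ℚ) [V.IsElliptic] [V.IsGloballyMinimal] (W : WeierstrassCurve ℚ) [W.IsElliptic]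
        [W.IsGloballyMinimal] (C : VariableChange ℚ) (p : ℕ) [Fact p.Prime],
        5 ≤ p → C • W.quadraticTwist ((-1) ^ (p / 2) * p) = V →
        V.HasGoodReductionAtPrime p → V.frobeniusTrace p = 0 →
        ¬ (∀ m : ℕ, V.HasSurjectiveModNGaloisRep (p ^ m : ℕ)) → V.HasCM → W.entireLFunction 1 = 0 →
        ∀ (κ : ZpExtension ℚ p), κ.IsCyclotomic →
          ∃ (γ : absoluteGaloisGroup ℚ) (D : W.FineSelmerDualData κ γ),
            Module.Finite ℤ_[p] (RestrictScalars ℤ_[p] (IwasawaAlgebra p) D.X))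
    (hμcm : ∀ (V : WeierstrassCurve ℚ) [V.IsElliptic] [V.IsGloballyMinimal] (p : ℕ) [Fact p.Prime],
        5 ≤ p → V.HasGoodReductionAtPrime p → V.frobeniusTrace p = 0 →
        ¬ (∀ m : ℕ, V.HasSurjectiveModNGaloisRep (p ^ m : ℕ)) → V.HasCM →
        ∀ {N : ℕ} [NeZero N] {f : CuspForm (Gamma0 N) 2}, IsNewformOf V f →
          ∀ (ϖ : ℚ), (if Even (p / 2) then (ϖ : ℝ) * V.realPeriodRat = plusPeriod f
              else (ϖ : ℝ) * V.imaginaryPeriodRat = minusPeriod f) →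
          ∀ (Lη : IwasawaAlgebra p), IsQuadraticBranchPlusLFunction f p ϖ Lη → HasUnitContent Lη)
    (huncong₁ : ∀ (V : WeierstrassCurve ℚ) [V.IsElliptic] [V.IsGloballyMinimal] (p : ℕ) [Fact p.Prime],
        5 ≤ p → V.HasGoodReductionAtPrime p → V.frobeniusTrace p = 0 →
        ¬ (∀ m : ℕ, V.HasSurjectiveModNGaloisRep (p ^ m : ℕ)) → ¬ V.HasCM →
        ¬ (∃ (V'' : WeierstrassCurve ℚ) (_ : V''.IsElliptic) (_ : V''.IsGloballyMinimal),
            V''.HasCM ∧ V''.HasGoodReductionAtPrime p ∧ V''.frobeniusTrace p = 0 ∧ ModPCongruent V'' V p) →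
        (∃ (W : WeierstrassCurve ℚ) (_ : W.IsElliptic) (_ : W.IsGloballyMinimal) (C : VariableChange ℚ),
            C • W.quadraticTwist ((-1 : ℚ) ^ (p / 2) * p) = V ∧ W.analyticRank ≤ 1) →
        QuadraticBranchPlusEtaMainConjectureAt V p) :
    ∀ (V : WeierstrassCurve ℚ) [V.IsElliptic] [V.IsGloballyMinimal] (p : ℕ) [Fact p.Prime],
      5 ≤ p → V.HasGoodReductionAtPrime p → V.frobeniusTrace p = 0 →
      ¬ (∀ m : ℕ, V.HasSurjectiveModNGaloisRep (p ^ m : ℕ)) →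
      (∃ (W : WeierstrassCurve ℚ) (_ : W.IsElliptic) (_ : W.IsGloballyMinimal) (C : VariableChange ℚ),
          C • W.quadraticTwist ((-1 : ℚ) ^ (p / 2) * p) = V ∧ W.analyticRank ≤ 1) →
      QuadraticBranchPlusEtaMainConjectureAt V p := by
  intro V _ _ p _ hp5 hgood hap hns hW
  have hp2 : p ≠ 2 := by omega
  have hcmRows := etaMC_cmRows_of_rankZeroPrint_of_conjAPosRank_of_analyticMu h26 h22 h6273 hmod hGZK hKO hS28 hAcmPos hμcm
  have hCL := EtaLambdaTransfer.corpuzLei2025_etaPlusMainConjecture_transfer_anMu_of_citeFacts h46 h53 h22 h41 hnf hGV hGVm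
  by_cases hCM : V.HasCM
  · exact hcmRows V p hp5 hgood hap hns hCM
  · by_cases hcg : ∃ (V'' : WeierstrassCurve ℚ) (_ : V''.IsElliptic) (_ : V''.IsGloballyMinimal),
        V''.HasCM ∧ V''.HasGoodReductionAtPrime p ∧ V''.frobeniusTrace p = 0 ∧ ModPCongruent V'' V p
    · obtain ⟨V'', _, _, hCM'', hgood'', hap'', hcong⟩ := hcg
      have hns'' : ¬ (∀ m : ℕ, V''.HasSurjectiveModNGaloisRep (p ^ m : ℕ)) := by
        intro h
        exact V''.not_hasSurjectiveModNGaloisRep_of_hasCM hCM'' (Fact.out) hp2 (by simpa using h 1)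
      exact EtaCMCongruentTransfer.quadraticBranchPlusEtaMainConjectureAt_of_congruent_of_transfer hCL p hp5 V'' hgood'' hap''
        (hcmRows V'' p hp5 hgood'' hap'' hns'' hCM'') (hμcm V'' p hp5 hgood'' hap'' hns'' hCM'') V hgood hap hcong
    · exact huncong₁ V p hp5 hgood hap hns hCM hcg hW

/-! ## §9 (APPENDED, same seat) The crux `_of` with Corpuz–Lei Thm. 4.5 cited in place of Thm. 5.3 -/

/-- **THE CRUX BY NAME with the cite input Corpuz–Lei Thm. 5.3 (`h53`) REPLACED by Thm. 4.5 (`h45`, the paper's central congruence of the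
Σ₀-imprimitive branch functions; named fact `CorpuzLei2025.thm45_etaPlusImprimitive_congruence_of_torsionIso`, p778190)** — §7 composed with
Part LII's kernel derivation `EtaImprimitiveTransfer.thm53_of_thm45` (p778676). Same content stubs ((A) on positive-rank CM partners, analytic
`μ` on CM rows, the uncongruent stub). CONDITIONAL; registers / closes no stub; nothing booked. [claim: CorpuzLei2025, status: under-review]
[cite: CorpuzLei2025, Thm. 4.5 and Thm. 5.3 (arXiv:2508.09733v2 pp. 13, 15)] [cite: Kobayashi2003, Thm. 2.2 (p. 5), §4 + Thm. 4.1 (p. 8)]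
[cite: BurungaleTian2026, Thm. 2.6] [cite: HatleyLei2019, Thm. 4.6, Prop. 5.1] [cite: GreenbergVatsal2000, §2 Prop. (2.4), §3 Remark 3.4] -/
theorem plusEtaMainConjectureNonsurj_of_cmConjAPosRank_of_analyticMu_of_uncongruent_of_citeFacts45
    (h22 : Kobayashi2003.thm22_etaSignedSelmerDual_finite_torsion)
    (h6273 : Kobayashi2003.thm62_63_73_etaColemanPoitouTate)
    (h26 : BurungaleTian2026.thm26_etaKatoSequences_charIdeal_upToP_of_cm)
    (h46 : HatleyLei2019.thm46_prop51_etaSignedMuLambda_transfer_of_torsionIso)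
    (h45 : CorpuzLei2025.thm45_etaPlusImprimitive_congruence_of_torsionIso)
    (h41 : Kobayashi2003.thm41_plusEtaCharIdeal_dvd)
    (hnf : exists_isNewformOf) (hGV : realPeriodRat_eq_unit_mul_plusPeriod)
    (hGVm : numRealComponents_mul_imaginaryPeriodRat_eq_unit_mul_minusPeriod_of_odd)
    (hmod : hasEntireLFunction_rat) (hGZK : rank_eq_analyticRank_of_analyticRank_le_one)
    (hKO : KitajimaOtsuki2018.mainThm13_etaSignedSelmerDual_noFiniteSubmodule)
    (hS28 : bsdTriple_of_hasCM_of_L_one_ne_zero)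
    (hAcmPos : ∀ (V : WeierstrassCurve ℚ) [V.IsElliptic] [V.IsGloballyMinimal] (W : WeierstrassCurve ℚ) [W.IsElliptic]
        [W.IsGloballyMinimal] (C : VariableChange ℚ) (p : ℕ) [Fact p.Prime],
        5 ≤ p → C • W.quadraticTwist ((-1) ^ (p / 2) * p) = V →
        V.HasGoodReductionAtPrime p → V.frobeniusTrace p = 0 →
        ¬ (∀ m : ℕ, V.HasSurjectiveModNGaloisRep (p ^ m : ℕ)) → V.HasCM → W.entireLFunction 1 = 0 →
        ∀ (κ : ZpExtension ℚ p), κ.IsCyclotomic →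
          ∃ (γ : absoluteGaloisGroup ℚ) (D : W.FineSelmerDualData κ γ),
            Module.Finite ℤ_[p] (RestrictScalars ℤ_[p] (IwasawaAlgebra p) D.X))
    (hμcm : ∀ (V : WeierstrassCurve ℚ) [V.IsElliptic] [V.IsGloballyMinimal] (p : ℕ) [Fact p.Prime],
        5 ≤ p → V.HasGoodReductionAtPrime p → V.frobeniusTrace p = 0 →
        ¬ (∀ m : ℕ, V.HasSurjectiveModNGaloisRep (p ^ m : ℕ)) → V.HasCM →
        ∀ {N : ℕ} [NeZero N] {f : CuspForm (Gamma0 N) 2}, IsNewformOf V f →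
          ∀ (ϖ : ℚ), (if Even (p / 2) then (ϖ : ℝ) * V.realPeriodRat = plusPeriod f
              else (ϖ : ℝ) * V.imaginaryPeriodRat = minusPeriod f) →
          ∀ (Lη : IwasawaAlgebra p), IsQuadraticBranchPlusLFunction f p ϖ Lη → HasUnitContent Lη)
    (huncong : ∀ (V : WeierstrassCurve ℚ) [V.IsElliptic] [V.IsGloballyMinimal] (p : ℕ) [Fact p.Prime],
        5 ≤ p → V.HasGoodReductionAtPrime p → V.frobeniusTrace p = 0 →
        ¬ (∀ m : ℕ, V.HasSurjectiveModNGaloisRep (p ^ m : ℕ)) → ¬ V.HasCM →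
        ¬ (∃ (V'' : WeierstrassCurve ℚ) (_ : V''.IsElliptic) (_ : V''.IsGloballyMinimal),
            V''.HasCM ∧ V''.HasGoodReductionAtPrime p ∧ V''.frobeniusTrace p = 0 ∧ ModPCongruent V'' V p) →
        QuadraticBranchPlusEtaMainConjectureAt V p) :
    PlusEtaMainConjectureNonsurj :=
  plusEtaMainConjectureNonsurj_of_cmConjAPosRank_of_analyticMu_of_uncongruent_of_citeFacts h22 h6273 h26 h46
    (EtaImprimitiveTransfer.thm53_of_thm45 h45) h41 hnf hGV hGVm hmod hGZK hKO hS28 hAcmPos hμcm huncong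

end EtaRankLeOneOf

end Summit.BirchSwinnertonDyer.BirchSwinnertonDyer.Theorems

end
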